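import Summits.QuantumFields.YangMills.Theorems.AlphaInputsT3ACMinimiserPinConsts
import Summits.QuantumFields.YangMills.Theorems.AlphaInputsT3ACv3DataSchemaRec
import HarnessLib

/-!
# `AlphaInputsT3ACMinimiserPinKnit` — LANE A's TRIVIAL-HISTORY PIN KNITTED INTO LANE B's ASSEMBLY: the v3 (α) package `AlphaInputsT3AC.OfV3At F 𝔠 a₀ a₁`
# from {[Balaban1985Variational] Thm 1 in the tree's global reading `Thm1GlobalMinAt` · (D6) non-emptiness of the adapted classes · the cluster-expansion
# data rows FOR EVERY PINNED trivial-history family · four size conditions on `𝔠`} — lane `pub-balaban3d`, seat alpha-1 (g6)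

Cell `ym3-torus`, route `UnitScaleTilt`, crux 2′ `stub_laneRecordsV3` (stmt-QuantumFields-19936 ∕ -19935).  Lane B (seat alpha-2) displays
`DataSchemaT3AC F 𝔠 a₀ a₁ = ∀ (γ, K), (N1) WindowIneqT3 ∧ (D6) AdaptedClassNonemptyT3 ∧ ∃ Ut, (D5) TrivMinimiserRowsT3 … Ut ∧ DataRowsT3 … Ut` and CONSTRUCTS
the package from it (`AlphaInputsT3AC.ofV3At_of_dataSchemaT3`, `alphaInputsT3ACv3Rec_of_dataSchemaRec`).  Lane A (this seat, owner ruling g20: «lane A owns the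
trivial-history pin») proved (D5) from `Thm1GlobalMinAt` and size conditions (`…MinimiserPinTriv`, `…MinimiserPinConsts`) and (N1) from the same size conditions.
THIS FILE is the knit: `AlphaInputsT3AC.dataSchemaT3AC_of_pinnedRows` ∕ `AlphaInputsT3AC.ofV3At_of_pinnedRows` — the schema, hence the package, from
* `Thm1GlobalMinAt F.L a₀ a₁ 𝔠.B₃` (DISPLAYED — print's [7] Theorem 1 + Prop 7, global reading, the 19200 lanes' target), `B₃a₁ ≤ a₀`, `2B₃a₁` Prop.-2-admissible;
* (D6) `AdaptedClassNonemptyT3` at every `(γ, K)` (DISPLAYED — kinematic);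
* the data rows FOR EVERY family `Ut` satisfying (D5): `∀ (γ, K) Ut, TrivMinimiserRowsT3 … Ut → DataRowsT3 … Ut` (DISPLAYED — the cluster expansion, [Balaban1985UV3] §§2–3);
* size conditions on the exhibited `𝔠`: `1 ≤ 2B₃`, `4B₃L²·avgWindowFactor(L) ≤ C68`, the record's window inside the antitone regime `(min γ₀ 1)² ≤ e^{2(1−p₀)}` and with
  (40)-windows inside the shell `2L²·avgWindowFactor(L)·θBal(K−k+1) ≤ a₁` — the last two met by `C68` large at fixed profile (`…MinimiserPinConsts` §2, §7).
So after this file 2′'s displayed content is exactly «[7] Thm 1 (as typed) + (D6) + the data rows + constants» — the (D5) existential is gone from the display.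
HONEST FRAMING.  Kernel theorem about the tree's own objects; nothing of the cluster expansion or of [7] is proved; count-neutral; the data rows are displayed FOR the
constructed∕pinned minimisers, not print's (42)-minimiser with its field history (lane B's honesty line, unchanged); not a claim about the continuum limit or the mass gap.
References: T. Bałaban, Commun. Math. Phys. 102 (1985) 255–275 [Balaban1985UV3], Thm 2 p. 272, (40)–(42) p. 266, (68) p. 273; Commun. Math. Phys. 102 (1985)
277–309 [Balaban1985Variational], Thm 1 (6)–(8) pp. 278–279.
-/

set_option autoImplicit false

noncomputable section

namespace Summit.QuantumFields.YangMills.Theorems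

open MeasureTheory
open scoped Matrix.Norms.L2Operator
open Literature.MathematicalPhysics.QuantumFieldTheory.Balaban1983to89
open Literature.MathematicalPhysics.QuantumFieldTheory.Balaban1983to89.T3ContinuumYM3Torus
open Literature.MathematicalPhysics.QuantumFieldTheory.Balaban1983to89.T3UnitScaleTilt (θBal)
open Literature.MathematicalPhysics.QuantumFieldTheory.Balaban1983to89.T3PrintedMinimiserExistence (Thm1GlobalMinAt)
open Literature.MathematicalPhysics.QuantumFieldTheory.Balaban1983to89.T3Thresholds (sqrt_le_exp_iff)
open Literature.MathematicalPhysics.QuantumFieldTheory.Balaban1983to89.ExpMeanLog (deltaSU)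
open Summit.QuantumFields.Balaban3D.Carriers
open Summit.QuantumFields.Balaban3D.Proofs.Primitives

/-- ★★ **LANE B's DISPLAYED SCHEMA FROM [7] THEOREM 1, (D6), THE DATA ROWS FOR EVERY PINNED FAMILY, AND SIZE CONDITIONS.** [cite: Balaban1985Variational, Thm 1 (6)–(8) pp.278–279; Balaban1985UV3, (40)–(42) p.266 and (68) p.273] -/
theorem AlphaInputsT3AC.dataSchemaT3AC_of_pinnedRows (F : T3Family) (𝔠 : AlphaConsts F.L (suGroupModel 2).N) {a₀ a₁ : ℝ}
    (hT : Thm1GlobalMinAt F.L a₀ a₁ 𝔠.B₃) (hwin : 𝔠.B₃ * a₁ ≤ a₀)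
    (hA3 : (143 * ((((3 + 4 : ℕ) : ℝ)) ^ 2 / 4) ^ 2) * (2 * (𝔠.B₃ * a₁)) ≤ 1 / 3)
    (hA2 : 2 * (2 * (𝔠.B₃ * a₁)) ≤ 2 * deltaSU (Fin 2) / (((3 + 4) * F.L : ℕ) : ℝ) ^ 2)
    (hB₃ : 1 ≤ 2 * 𝔠.B₃) (hC : 4 * 𝔠.B₃ * (F.L : ℝ) ^ 2 * avgWindowFactor F.L ≤ 𝔠.C68)
    (hanti : (min 𝔠.gamma0 1) ^ 2 ≤ Real.exp (2 * (1 - 𝔠.p₀)))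
    (hsmall : ∀ γ : ℝ, 0 < γ → γ ≤ (min 𝔠.gamma0 1) ^ 2 →
      ∀ K k : ℕ, 2 * (F.L : ℝ) ^ 2 * avgWindowFactor F.L * θBal F.L γ 𝔠.b₀ 𝔠.p₀ (K - k + 1) ≤ a₁)
    (hD6 : ∀ (γ : ℝ) (hγ : 0 < γ) (hγ1 : γ ≤ (min 𝔠.gamma0 1) ^ 2) (K : ℕ), AlphaInputsT3AC.AdaptedClassNonemptyT3 F 𝔠 γ hγ hγ1 K)
    (hrows : ∀ (γ : ℝ) (hγ : 0 < γ) (hγ1 : γ ≤ (min 𝔠.gamma0 1) ^ 2) (K : ℕ)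
      (Ut : (k : ℕ) → GaugeField (F.P K) k (Matrix.specialUnitaryGroup (Fin 2) ℂ) → GaugeField (F.P K) 0 (Matrix.specialUnitaryGroup (Fin 2) ℂ)),
      AlphaInputsT3AC.TrivMinimiserRowsT3 F 𝔠 γ hγ hγ1 a₀ a₁ K Ut → AlphaInputsT3AC.DataRowsT3 F 𝔠 γ hγ hγ1 K Ut) :
    DataSchemaT3AC F 𝔠 a₀ a₁ := by
  intro γ hγ hγ1 K
  have hγ1' : γ ≤ 1 := hγ1.trans (sq_min_one_le _ 𝔠.gamma0_pos)
  have hγe : Real.sqrt γ ≤ Real.exp (1 - 𝔠.p₀) := (sqrt_le_exp_iff hγ.le).mpr (hγ1.trans hanti)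
  have hL1 : 1 ≤ F.L := by have := F.hL.2; omega
  have hw0 : 0 ≤ (F.L : ℝ) ^ 2 * avgWindowFactor F.L := by
    have := avgWindowFactor_pos F
    positivity
  have hC2 : 2 * (F.L : ℝ) ^ 2 * avgWindowFactor F.L ≤ 𝔠.C68 := by nlinarith
  refine ⟨MinimiserPin.windowIneqT3_of_le F 𝔠 hγ hγ1' hγe hC2 K, hD6 γ hγ hγ1 K, ?_⟩
  obtain ⟨Ut, hUt⟩ := AlphaInputsT3AC.trivMinimiserRowsT3_of_thm1GlobalMinAt F 𝔠 γ hγ hγ1 K hT hwin hA3 hA2 hB₃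
    (fun k _ => hsmall γ hγ hγ1 K k)
    (fun k i hik hkK => MinimiserPin.C68_dom_of_le hL1 hγ hγ1' hγe 𝔠.b₀_pos 𝔠.p₀_pos.le (avgWindowFactor_pos F).le 𝔠.B₃_pos.le hC K k i hik hkK)
  exact ⟨Ut, hUt, hrows γ hγ hγ1 K Ut hUt⟩

/-- ★★ **THE v3 (α) PACKAGE FROM THE SAME** (through lane B's `AlphaInputsT3AC.ofV3At_of_dataSchemaT3`). [cite: Balaban1985UV3, Thm 2 p.272; Balaban1985Variational, Thm 1 (8) p.279] -/
theorem AlphaInputsT3AC.ofV3At_of_pinnedRows (F : T3Family) (𝔠 : AlphaConsts F.L (suGroupModel 2).N) {a₀ a₁ : ℝ}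
    (hT : Thm1GlobalMinAt F.L a₀ a₁ 𝔠.B₃) (hwin : 𝔠.B₃ * a₁ ≤ a₀)
    (hA3 : (143 * ((((3 + 4 : ℕ) : ℝ)) ^ 2 / 4) ^ 2) * (2 * (𝔠.B₃ * a₁)) ≤ 1 / 3)
    (hA2 : 2 * (2 * (𝔠.B₃ * a₁)) ≤ 2 * deltaSU (Fin 2) / (((3 + 4) * F.L : ℕ) : ℝ) ^ 2)
    (hB₃ : 1 ≤ 2 * 𝔠.B₃) (hC : 4 * 𝔠.B₃ * (F.L : ℝ) ^ 2 * avgWindowFactor F.L ≤ 𝔠.C68)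
    (hanti : (min 𝔠.gamma0 1) ^ 2 ≤ Real.exp (2 * (1 - 𝔠.p₀)))
    (hsmall : ∀ γ : ℝ, 0 < γ → γ ≤ (min 𝔠.gamma0 1) ^ 2 →
      ∀ K k : ℕ, 2 * (F.L : ℝ) ^ 2 * avgWindowFactor F.L * θBal F.L γ 𝔠.b₀ 𝔠.p₀ (K - k + 1) ≤ a₁)
    (hD6 : ∀ (γ : ℝ) (hγ : 0 < γ) (hγ1 : γ ≤ (min 𝔠.gamma0 1) ^ 2) (K : ℕ), AlphaInputsT3AC.AdaptedClassNonemptyT3 F 𝔠 γ hγ hγ1 K)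
    (hrows : ∀ (γ : ℝ) (hγ : 0 < γ) (hγ1 : γ ≤ (min 𝔠.gamma0 1) ^ 2) (K : ℕ)
      (Ut : (k : ℕ) → GaugeField (F.P K) k (Matrix.specialUnitaryGroup (Fin 2) ℂ) → GaugeField (F.P K) 0 (Matrix.specialUnitaryGroup (Fin 2) ℂ)),
      AlphaInputsT3AC.TrivMinimiserRowsT3 F 𝔠 γ hγ hγ1 a₀ a₁ K Ut → AlphaInputsT3AC.DataRowsT3 F 𝔠 γ hγ hγ1 K Ut) :
    AlphaInputsT3AC.OfV3At F 𝔠 a₀ a₁ :=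
  AlphaInputsT3AC.ofV3At_of_dataSchemaT3 (AlphaInputsT3AC.dataSchemaT3AC_of_pinnedRows F 𝔠 hT hwin hA3 hA2 hB₃ hC hanti hsmall hD6 hrows)

/-- **THE TWO `γ`-CONDITIONS FROM ONE SIZE CONDITION ON `C68`** at fixed profile: if `(3C₀(3)·C68·b₀Q₀(p₀))⁻² ≤ min γ₁ e^{2(1−p₀)}` for a `γ₁` of
`MinimiserPin.exists_gamma_window`, then the record's window is inside the antitone regime and its (40)-windows inside the shell (`…MinimiserPinConsts` §7).
[cite: Balaban1985UV3, p.256 L15–18, (7) p.257, (40) p.266 and (68)–(71) p.273 (bookkeeping)] -/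
theorem AlphaInputsT3AC.gammaConditions_of_C68 (F : T3Family) (𝔠 : AlphaConsts F.L (suGroupModel 2).N) {a₁ γ₁ : ℝ}
    (hγ₁ : ∀ γ : ℝ, 0 < γ → γ ≤ γ₁ → ∀ K k : ℕ, 2 * (F.L : ℝ) ^ 2 * avgWindowFactor F.L * θBal F.L γ 𝔠.b₀ 𝔠.p₀ (K - k + 1) ≤ a₁)
    (hbig : ((3 * B7Prop2Explicit.C0 3 * 𝔠.C68 * (𝔠.b₀ * Summit.QuantumFields.Balaban3D.Proofs.Thresholds.Q0 𝔠.p₀))⁻¹) ^ 2 ≤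
      min γ₁ (Real.exp (2 * (1 - 𝔠.p₀)))) :
    (min 𝔠.gamma0 1) ^ 2 ≤ Real.exp (2 * (1 - 𝔠.p₀)) ∧
      ∀ γ : ℝ, 0 < γ → γ ≤ (min 𝔠.gamma0 1) ^ 2 →
        ∀ K k : ℕ, 2 * (F.L : ℝ) ^ 2 * avgWindowFactor F.L * θBal F.L γ 𝔠.b₀ 𝔠.p₀ (K - k + 1) ≤ a₁ :=
  ⟨MinimiserPin.window_le_of_C68 𝔠 le_rfl (hbig.trans (min_le_right _ _)),
    fun γ hγ hγ1 K k => hγ₁ γ hγ (MinimiserPin.window_le_of_C68 𝔠 hγ1 (hbig.trans (min_le_left _ _))) K k⟩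

end Summit.QuantumFields.YangMills.Theorems

end
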